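import Literature.Geometry.Lorentzian.MullerZumHagenAnalyticity
import Literature.Geometry.Lorentzian.StationaryComovingChart
import HarnessLib

/-!
# Müller zum Hagen 1970: stationary harmonic coordinates, and analyticity of the vacuum metric in that gauge
(the two halves of the printed proof as named facts, and the assembly of `mullerZumHagen1970_analytic_of_timelikeKilling`)

Topic `Literature/Geometry/Lorentzian`. Decomposition (librarian `fact-decompose`, 2026-08-16) of
the XL named fact `mullerZumHagen1970_analytic_of_timelikeKilling` (`MullerZumHagenAnalyticity.lean`;
H. Müller zum Hagen, Proc. Camb. Phil. Soc. 68 (1970) 199–201: a vacuum metric is real-analytic in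
suitable coordinates near every point where a Killing field is timelike) along the seam of its
printed proof (restated in P. Tod, Gen. Rel. Grav. 39 (2007), §3.1):

1. **Coordinates** (`mullerZumHagen1970_stationaryHarmonicChart`). Near a point where the Killing
   field `K` is timelike there is a chart of the maximal `C^∞` atlas in which `K = ∂₀` (comoving:
   the tree's proved `StationaryAFBlackHole.exists_comovingChart_of_timelike`, Tod Thm. 3.1) and
   whose four coordinate functions are harmonic, `□_g x^a = 0` (Müller zum Hagen: harmonic
   coordinates adapted to the stationary Killing field, obtained from a comoving chart by solving,
   on the space of orbits, the linear elliptic equations `□(t + f) = 0`, `□ yⁱ = 0` with `f`, `yⁱ`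
   independent of `t` — local solvability of smooth elliptic equations, cf. the tree's named fact
   `Literature.Analysis.Distribution.Folland1995_thm845`, and a `C¹`-small correction to keep a
   coordinate system), on whose domain `K` stays timelike.
2. **Analyticity in the gauge** (`mullerZumHagen1970_analytic_in_stationaryHarmonicGauge`). In such
   a chart the components `g_ab` do not depend on `x⁰` (Killing equation, the tree's
   `PseudoRiemannianMetric.hasDerivAt_val_coordVector_of_killing_at`), and the vacuum equations in
   harmonic gauge, `R_ab = −½ g^{cd} ∂_c ∂_d g_ab + Q_ab(g, ∂g) = 0`, reduce on the slices
   `x⁰ = const` to the quasilinear system `g^{ij} ∂ᵢ∂ⱼ g_ab = 2 Q_ab(g, ∂ₓ g)` (`i, j = 1, 2, 3`) whose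
   principal symbol `g^{ij} ξᵢ ξⱼ` is positive definite exactly because `∂₀ = K` is timelike, with
   coefficients rational in `g` and polynomial in `∂g`, hence real-analytic; by Morrey's theorem
   (the tree's named fact `Literature.Analysis.PDE.Morrey1958_analyticOnNhd_of_quasilinearElliptic`,
   the remaining analytic input — to be taken as the blocker of child 2) the `g_ab` are real-analytic
   functions of `(x¹, x², x³)`, hence of all four coordinates.

`mullerZumHagen1970_analytic_of_timelikeKilling_holds_of : (1) → (2) → parent` is proved here (the
chart of (1) is the witness; (2) gives the analyticity of every component on its target). Neither
child restates the parent: (1) asserts nothing about analyticity, (2) is the gauge-fixed PDE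
statement. No other definition.

## References

* [MullerZumHagen1970] H. Müller zum Hagen, *On the analyticity of stationary vacuum solutions of
  Einstein's equations*, Proc. Camb. Phil. Soc. 68 (1970) 199–201 (the whole note: §2 coordinates,
  §3 ellipticity of the reduced system and Morrey's theorem).
* [Tod2007] P. Tod, Gen. Rel. Grav. 39 (2007) 1031–1042, §3.1, Thm. 3.1 and the paragraph after it.
* [Morrey1958AnalyticityI] C. B. Morrey Jr., Amer. J. Math. 80 (1958) 198–218.
* [HawkingEllis1973] S. W. Hawking, G. F. R. Ellis, *The Large Scale Structure of Space-Time*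
  (1973), §9.3 p. 324.
-/

noncomputable section

open Bundle Set
open scoped Manifold ContDiff Topology

namespace Literature.Geometry.Lorentzian

/-- NAMED FACT — **Müller zum Hagen 1970, step 1: stationary harmonic coordinates about a point where
a Killing field is timelike.** On a `StationaryAFBlackHole` carrier with metric `g` (Levi-Civita
connection `∇`), let `K` be a vector field of class `C^∞` on the open set `U` satisfying the Killing
equation `g(∇_v K, w) + g(v, ∇_w K) = 0` on `U`, and let `y ∈ U` with `g(K, K)(y) < 0`. Then there is
a chart `ψ` of the maximal `C^∞` atlas with `y ∈ ψ.source ⊆ U` such that: `K` is timelike on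
`ψ.source`; `K` is the first coordinate field, `dψ_x(K x) = 𝐞₀` for `x ∈ ψ.source` (comoving,
Tod 2007 Thm. 3.1); and the four coordinate functions `x ↦ (ψ x)_a` are `g`-harmonic on `ψ.source`,
`□_g (ψ)_a = 0` (`PseudoRiemannianMetric.dalembertian`; Müller zum Hagen's harmonic coordinates
adapted to the stationary Killing field). [cite: MullerZumHagen1970, Theorem, §2 (construction of the coordinates)] [cite: Tod2007, §3.1, Thm. 3.1] -/
def mullerZumHagen1970_stationaryHarmonicChart : Prop :=
  ∀ (𝓑 : StationaryAFBlackHole.{0}) [𝓑.metric.HasLeviCivita]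
    (U : Set 𝓑.carrier) (K : Π x : 𝓑.carrier, TangentSpace (𝓡 4) x), IsOpen U →
      ContMDiffOn (𝓡 4) ((𝓡 4).prod 𝓘(ℝ, E4)) ((⊤ : ℕ∞) : WithTop ℕ∞)
        (fun x ↦ (TotalSpace.mk' E4 x (K x) : TangentBundle (𝓡 4) 𝓑.carrier)) U →
      (∀ x ∈ U, ∀ v w : TangentSpace (𝓡 4) x,
        𝓑.metric.val x (𝓑.metric.leviCivita K x v) w + 𝓑.metric.val x v (𝓑.metric.leviCivita K x w) = 0) →
      ∀ y ∈ U, 𝓑.metric.val y (K y) (K y) < 0 →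
        ∃ ψ ∈ IsManifold.maximalAtlas (𝓡 4) ((⊤ : ℕ∞) : WithTop ℕ∞) 𝓑.carrier,
          y ∈ ψ.source ∧ ψ.source ⊆ U ∧
          (∀ x ∈ ψ.source, 𝓑.metric.val x (K x) (K x) < 0) ∧
          (∀ x ∈ ψ.source,
            mfderiv (𝓡 4) (𝓡 4) ψ x (K x) = (EuclideanSpace.single (0 : Fin 4) (1 : ℝ) : E4)) ∧
          (∀ x ∈ ψ.source, ∀ a : Fin 4,
            𝓑.metric.toPseudoRiemannianMetric.dalembertian (fun z ↦ EuclideanSpace.proj a (ψ z)) x = 0)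

/-- NAMED FACT — **Müller zum Hagen 1970, step 2: a vacuum metric is real-analytic in stationary
harmonic coordinates.** On a `StationaryAFBlackHole` carrier with Ricci-flat metric `g`, let `K` be
`C^∞` and Killing on the open set `U`, and let `ψ` be a chart of the maximal `C^∞` atlas with
`ψ.source ⊆ U` on which `K` is timelike, `K = ∂₀` (`dψ_x(K x) = 𝐞₀`) and the coordinate functions
are `g`-harmonic (`□_g (ψ)_a = 0`). Then every metric component
`p ↦ g_{ψ⁻¹ p}(dψ⁻¹_p a, dψ⁻¹_p b)` (`a, b ∈ E4`) is real-analytic on `ψ.target` — the components are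
`x⁰`-independent (Killing), the vacuum equations in harmonic gauge are, slice by slice, a
quasilinear elliptic system with real-analytic coefficients whose symbol `g^{ij}ξᵢξⱼ` is positive
definite because `∂₀` is timelike, and Morrey's theorem applies (tree: the named fact
`Literature.Analysis.PDE.Morrey1958_analyticOnNhd_of_quasilinearElliptic`, the analytic input of
this fact). [cite: MullerZumHagen1970, Theorem, §3 (ellipticity of the reduced vacuum equations; Morrey)] [cite: Tod2007, §3.1 (after Thm. 3.1)]
[cite: Morrey1958AnalyticityI, Part I] -/
def mullerZumHagen1970_analytic_in_stationaryHarmonicGauge : Prop :=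
  ∀ (𝓑 : StationaryAFBlackHole.{0}) [𝓑.metric.HasLeviCivita],
    𝓑.metric.toPseudoRiemannianMetric.IsRicciFlat →
    ∀ (U : Set 𝓑.carrier) (K : Π x : 𝓑.carrier, TangentSpace (𝓡 4) x)
      (ψ : OpenPartialHomeomorph 𝓑.carrier E4), IsOpen U →
      ContMDiffOn (𝓡 4) ((𝓡 4).prod 𝓘(ℝ, E4)) ((⊤ : ℕ∞) : WithTop ℕ∞)
        (fun x ↦ (TotalSpace.mk' E4 x (K x) : TangentBundle (𝓡 4) 𝓑.carrier)) U →
      (∀ x ∈ U, ∀ v w : TangentSpace (𝓡 4) x,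
        𝓑.metric.val x (𝓑.metric.leviCivita K x v) w + 𝓑.metric.val x v (𝓑.metric.leviCivita K x w) = 0) →
      ψ ∈ IsManifold.maximalAtlas (𝓡 4) ((⊤ : ℕ∞) : WithTop ℕ∞) 𝓑.carrier →
      ψ.source ⊆ U →
      (∀ x ∈ ψ.source, 𝓑.metric.val x (K x) (K x) < 0) →
      (∀ x ∈ ψ.source,
        mfderiv (𝓡 4) (𝓡 4) ψ x (K x) = (EuclideanSpace.single (0 : Fin 4) (1 : ℝ) : E4)) →
      (∀ x ∈ ψ.source, ∀ a : Fin 4,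
        𝓑.metric.toPseudoRiemannianMetric.dalembertian (fun z ↦ EuclideanSpace.proj a (ψ z)) x = 0) →
      ∀ a b : E4,
        AnalyticOnNhd ℝ (fun p : E4 ↦ 𝓑.metric.val (ψ.symm p)
          (mfderiv 𝓘(ℝ, E4) (𝓡 4) ψ.symm p a) (mfderiv 𝓘(ℝ, E4) (𝓡 4) ψ.symm p b)) ψ.target

/-- **Müller zum Hagen's theorem (`mullerZumHagen1970_analytic_of_timelikeKilling`) from its two
halves** — the decomposition assembly: the stationary harmonic chart of step 1 about `y` is the
required chart, its components being real-analytic on its target by step 2.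
[cite: MullerZumHagen1970, Theorem (pp. 199–201)] [cite: HawkingEllis1973, §9.3 p. 324] -/
theorem mullerZumHagen1970_analytic_of_timelikeKilling_holds_of :
    mullerZumHagen1970_stationaryHarmonicChart →
      mullerZumHagen1970_analytic_in_stationaryHarmonicGauge →
        mullerZumHagen1970_analytic_of_timelikeKilling := by
  intro h1 h2 𝓑 _ hRic U K hU hK hKill y hy hKy
  obtain ⟨ψ, hψ, hyψ, hψU, htl, hK0, hharm⟩ := h1 𝓑 U K hU hK hKill y hy hKy
  exact ⟨ψ, hψ, hyψ, h2 𝓑 hRic U K ψ hU hK hKill hψ hψU htl hK0 hharm⟩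

end Literature.Geometry.Lorentzian

end
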